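import Summits.HubbardSuperconductivity.HubbardLadder.PsdCertCheck

/-!
# PsdCert, II — soundness of the kernel-decided positive-semidefiniteness certificate

HONEST FRAMING: ladder R1–R4 with certified numbers; no claim on H/H₀; first certified bounds; not a superconductivity
verdict.  FILE SPLIT (400-line rule; FILER lit g35): part II of the staged master `psdcert-g12/lean-staged/PsdCert.lean`
83d79bad0b552655 (cell pub-hubbard, lane r2-eng-1 g12) — §3 soundness `psdCert n s μ B = true → 0 ≤ xᵀ B x` for every real
`x` (`form_nonneg_of_psdCert`) and the `Matrix.PosSemidef` form (`posSemidef_of_psdCert`): `s² B = L̂ D̂ L̂ᵀ + E` with both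
summands positive semidefinite (Gershgorin for the diagonally dominant exact residual `E`); §4 a kernel-decided smoke test.
Part I (`PsdCertCheck.lean`) holds §1 the untrusted fixed-point LDLᵀ oracle and §2 the verified check `psdCert`; the bodies of
both parts are byte-identical to the master; only this header, the import and the namespace lines were added.
References: Golub–Van Loan (2013) §4.1 (LDLᵀ), Horn–Johnson (2013) Thm 6.1.10 (diagonal dominance ⇒ PSD), Rump (2006)
«Verification of positive definiteness».  All statements [folklore].
-/

namespace Summit.HubbardSuperconductivity.HubbardLadder.PsdCert

open Finset

/-! ## §3 Soundness -/

section Semantics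

/-- `dot3` is the triple sum over any index range covering the first list. [folklore] -/
theorem dot3_eq_sum (a d b : List ℤ) (M : ℕ) (hM : a.length ≤ M) :
    dot3 a d b = ∑ k ∈ range M, a.getD k 0 * d.getD k 0 * b.getD k 0 := by
  induction a generalizing d b M with
  | nil =>
    simp [dot3]
  | cons x xs ih =>
    cases d with
    | nil =>
      cases b <;> simp [dot3]
    | cons y ys =>
      cases b with
      | nil => simp [dot3]
      | cons z zs =>
        obtain ⟨M', rfl⟩ : ∃ M', M = M' + 1 := ⟨M - 1, by simp at hM; omega⟩
        rw [Finset.sum_range_succ']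
        simp only [List.getD_cons_succ, List.getD_cons_zero, dot3]
        rw [ih ys zs M' (by simpa using hM)]
        change x * y * z + _ = _
        ring

/-- `dot3` is symmetric in its outer arguments. [folklore] -/
theorem dot3_comm (a d b : List ℤ) : dot3 a d b = dot3 b d a := by
  rw [dot3_eq_sum a d b (max a.length b.length) (le_max_left _ _),
    dot3_eq_sum b d a (max a.length b.length) (le_max_right _ _)]
  exact Finset.sum_congr rfl fun k _ => by ring

/-- `absSum` is the sum of absolute values of the entries. [folklore] -/
theorem absSum_eq (row : List ℤ) : absSum row = ∑ j ∈ range row.length, |row.getD j 0| := by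
  induction row with
  | nil => simp [absSum]
  | cons e es ih =>
    rw [absSum, ih, List.length_cons, Finset.sum_range_succ']
    simp [add_comm]

/-- `offAbs i row = Σ_{j < |row|, j ≠ i} |row_j|`. [folklore] -/
theorem offAbs_eq (i : ℕ) (row : List ℤ) :
    offAbs i row = ∑ j ∈ range row.length, if j = i then 0 else |row.getD j 0| := by
  induction row generalizing i with
  | nil => simp [offAbs]
  | cons e es ih =>
    cases i with
    | zero =>
      rw [offAbs, absSum_eq, List.length_cons, Finset.sum_range_succ']
      simp
    | succ i =>
      rw [offAbs, ih, List.length_cons, Finset.sum_range_succ']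
      simp only [List.getD_cons_succ, List.getD_cons_zero, add_comm]
      congr 1
      exact Finset.sum_congr rfl fun j _ => by simp only [Nat.add_right_cancel_iff]

/-- Semantics of `ddRows`: every row `i0 + t` (for the `t`-th remaining pair) passes the dominance test. [folklore] -/
theorem ddRows_spec (s2 : ℤ) (D : List ℤ) (Lrows : List (List ℤ)) :
    ∀ (Bs Ls : List (List ℤ)) (i0 : ℕ), ddRows s2 D Lrows i0 Bs Ls = true →
      ∀ t < Bs.length, t < Ls.length ∧
        (let r := erow s2 D Lrows (Bs.getD t []) (Ls.getD t [])
         offAbs (i0 + t) r ≤ r.getD (i0 + t) 0) := by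
  intro Bs
  induction Bs with
  | nil => intro Ls i0 _ t ht; simp at ht
  | cons Bi Bs ih =>
    intro Ls i0 h t ht
    cases Ls with
    | nil => simp [ddRows] at h
    | cons Li Ls =>
      simp only [ddRows, Bool.and_eq_true, decide_eq_true_eq, offAbsAcc_eq, zero_add] at h
      cases t with
      | zero => simpa using h.1
      | succ t =>
        have := ih Ls (i0 + 1) h.2 t (by simpa using ht)
        simp only [List.length_cons, add_lt_add_iff_right, List.getD_cons_succ]
        refine ⟨this.1, ?_⟩
        have e : i0 + (t + 1) = i0 + 1 + t := by ring
        rw [e]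
        exact this.2

end Semantics

section Algebra

variable {n : ℕ}

/-- **Gershgorin / diagonal dominance ⇒ nonnegative form**: a symmetric real kernel `e` on `Fin n` with
`Σ_{j ≠ i} |e i j| ≤ e i i` for all `i` has `0 ≤ Σ_i Σ_j x_i e_ij x_j`. [folklore] -/
theorem form_nonneg_of_diagDominant (e : Fin n → Fin n → ℝ) (hsymm : ∀ i j, e i j = e j i)
    (hdd : ∀ i, (∑ j, if j = i then 0 else |e i j|) ≤ e i i) (x : Fin n → ℝ) :
    0 ≤ ∑ i, ∑ j, x i * e i j * x j := by
  -- split the diagonal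
  have hsplit : ∀ i, ∑ j, x i * e i j * x j =
      e i i * x i ^ 2 + ∑ j, if j = i then 0 else x i * e i j * x j := by
    intro i
    have hj : ∀ j, x i * e i j * x j =
        (if j = i then e i i * x i ^ 2 else 0) + (if j = i then 0 else x i * e i j * x j) := by
      intro j
      by_cases h : j = i
      · subst h; simp only [if_true, add_zero]; ring
      · simp only [h, if_false, zero_add]
    rw [Finset.sum_congr rfl (fun j _ => hj j), Finset.sum_add_distrib]
    congr 1
    simp
  -- lower bound for each off-diagonal term
  have hoff : ∀ i j, -(|e i j| * (x i ^ 2 + x j ^ 2) / 2) ≤ x i * e i j * x j := by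
    intro i j
    have h1 : |x i * x j| ≤ (x i ^ 2 + x j ^ 2) / 2 := by
      rw [abs_mul]
      nlinarith [sq_nonneg (|x i| - |x j|), sq_abs (x i), sq_abs (x j), abs_nonneg (x i), abs_nonneg (x j)]
    have h2 : -(|e i j| * |x i * x j|) ≤ x i * e i j * x j := by
      have : |x i * e i j * x j| = |e i j| * |x i * x j| := by
        rw [show x i * e i j * x j = e i j * (x i * x j) by ring, abs_mul]
      linarith [neg_abs_le (x i * e i j * x j)]
    nlinarith [abs_nonneg (e i j)]
  -- sum up
  have step1 : ∑ i, (e i i * x i ^ 2 - ∑ j, if j = i then 0 else |e i j| * (x i ^ 2 + x j ^ 2) / 2) ≤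
      ∑ i, ∑ j, x i * e i j * x j := by
    refine Finset.sum_le_sum fun i _ => ?_
    rw [hsplit i, sub_eq_add_neg, ← Finset.sum_neg_distrib]
    refine add_le_add le_rfl (Finset.sum_le_sum fun j _ => ?_)
    split_ifs
    · simp
    · exact hoff i j
  -- the symmetric rearrangement: Σ_i Σ_{j≠i} |e_ij| x_j² = Σ_i Σ_{j≠i} |e_ij| x_i²
  have hswap : ∑ i, ∑ j, (if j = i then 0 else |e i j| * x j ^ 2) = ∑ i, ∑ j, (if j = i then 0 else |e i j| * x i ^ 2) := by
    rw [Finset.sum_comm]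
    refine Finset.sum_congr rfl fun i _ => Finset.sum_congr rfl fun j _ => ?_
    by_cases h : i = j
    · subst h; simp
    · rw [if_neg h, if_neg (Ne.symm h), hsymm j i]
  have step2 : ∑ i, (e i i * x i ^ 2 - ∑ j, if j = i then 0 else |e i j| * (x i ^ 2 + x j ^ 2) / 2) =
      ∑ i, (e i i - ∑ j, if j = i then 0 else |e i j|) * x i ^ 2 := by
    have hhalf : ∀ i, (∑ j, if j = i then 0 else |e i j| * (x i ^ 2 + x j ^ 2) / 2) =
        (∑ j, if j = i then 0 else |e i j| * x i ^ 2) / 2 + (∑ j, if j = i then 0 else |e i j| * x j ^ 2) / 2 := by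
      intro i
      rw [← add_div, ← Finset.sum_add_distrib, Finset.sum_div]
      refine Finset.sum_congr rfl fun j _ => ?_
      split_ifs <;> ring
    simp_rw [hhalf]
    rw [Finset.sum_sub_distrib, Finset.sum_add_distrib, ← Finset.sum_div, ← Finset.sum_div, hswap, ← add_div,
      ← two_mul, mul_div_cancel_left₀ _ (two_ne_zero), ← Finset.sum_sub_distrib]
    refine Finset.sum_congr rfl fun i _ => ?_
    rw [sub_mul, Finset.sum_mul]
    congr 1
    exact Finset.sum_congr rfl fun j _ => by split_ifs <;> simp
  have step3 : 0 ≤ ∑ i, (e i i - ∑ j, if j = i then 0 else |e i j|) * x i ^ 2 :=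
    Finset.sum_nonneg fun i _ => mul_nonneg (sub_nonneg.mpr (hdd i)) (sq_nonneg _)
  linarith

/-- **A Gram-type form `Σ_k D_k (Σ_i L_ik x_i)²` with `D ≥ 0` is nonnegative.** [folklore] -/
theorem form_nonneg_of_gram (M : ℕ) (L : Fin n → ℕ → ℝ) (D : ℕ → ℝ) (hD : ∀ k, 0 ≤ D k) (x : Fin n → ℝ) :
    0 ≤ ∑ i, ∑ j, x i * (∑ k ∈ range M, L i k * D k * L j k) * x j := by
  have key : ∑ i, ∑ j, x i * (∑ k ∈ range M, L i k * D k * L j k) * x j =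
      ∑ k ∈ range M, D k * ((∑ i, L i k * x i) * (∑ j, L j k * x j)) := by
    calc ∑ i, ∑ j, x i * (∑ k ∈ range M, L i k * D k * L j k) * x j
        = ∑ i, ∑ j, ∑ k ∈ range M, D k * ((L i k * x i) * (L j k * x j)) := by
          refine Finset.sum_congr rfl fun i _ => Finset.sum_congr rfl fun j _ => ?_
          rw [Finset.mul_sum, Finset.sum_mul]
          exact Finset.sum_congr rfl fun k _ => by ring
      _ = ∑ i, ∑ k ∈ range M, ∑ j, D k * ((L i k * x i) * (L j k * x j)) :=
          Finset.sum_congr rfl fun i _ => Finset.sum_comm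
      _ = ∑ k ∈ range M, ∑ i, ∑ j, D k * ((L i k * x i) * (L j k * x j)) := Finset.sum_comm
      _ = ∑ k ∈ range M, D k * ((∑ i, L i k * x i) * (∑ j, L j k * x j)) := by
          refine Finset.sum_congr rfl fun k _ => ?_
          rw [Finset.sum_mul_sum, Finset.mul_sum]
          exact Finset.sum_congr rfl fun i _ => by rw [Finset.mul_sum]
  rw [key]
  exact Finset.sum_nonneg fun k _ => mul_nonneg (hD k) (mul_self_nonneg _)

end Algebra

section Main

/-- `isSquare` semantics. [folklore] -/
theorem isSquare_spec {n : ℕ} {B : List (List ℤ)} (h : isSquare n B = true) :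
    B.length = n ∧ ∀ r ∈ B, r.length = n := by
  simp only [isSquare, Bool.and_eq_true, decide_eq_true_eq, List.all_eq_true] at h
  exact ⟨h.1, fun r hr => h.2 r hr⟩

/-- `isSymm` semantics. [folklore] -/
theorem isSymm_spec {n : ℕ} {B : List (List ℤ)} (h : isSymm n B = true) {i j : ℕ} (hi : i < n) (hj : j < n) :
    ent B i j = ent B j i := by
  simp only [isSymm, List.all_eq_true, List.mem_range, decide_eq_true_eq] at h
  exact h i hi j hj

/-- `getD` beyond the length of a list of nonnegative integers is still nonnegative. [folklore] -/
theorem getD_nonneg_of_all {D : List ℤ} (h : D.all (fun d => decide (0 ≤ d)) = true) (k : ℕ) : 0 ≤ D.getD k 0 := by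
  simp only [List.all_eq_true, decide_eq_true_eq] at h
  by_cases hk : k < D.length
  · rw [List.getD_eq_getElem _ _ hk]; exact h _ (List.getElem_mem hk)
  · rw [List.getD_eq_default _ _ (by omega)]

/-- Entry `j` of the residual row (both lists of length `n`, `j < n`). [folklore] -/
theorem erow_getD (s2 : ℤ) (D : List ℤ) (Lrows : List (List ℤ)) (Bi Li : List ℤ) {n : ℕ}
    (hBi : Bi.length = n) (hL : Lrows.length = n) {j : ℕ} (hj : j < n) :
    (erow s2 D Lrows Bi Li).getD j 0 = Bi.getD j 0 * s2 - dot3 Li D (Lrows.getD j []) := by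
  unfold erow
  have hlen : j < (List.zipWith (fun bij lj => Int.sub (Int.mul bij s2) (dot3acc 0 Li D lj)) Bi Lrows).length := by
    rw [List.length_zipWith]; omega
  rw [List.getD_eq_getElem _ _ hlen, List.getElem_zipWith, List.getD_eq_getElem _ _ (by omega),
    List.getD_eq_getElem _ _ (by omega), dot3acc_eq, zero_add]
  rfl

/-- Length of a residual row. [folklore] -/
theorem erow_length (s2 : ℤ) (D : List ℤ) (Lrows : List (List ℤ)) (Bi Li : List ℤ) :
    (erow s2 D Lrows Bi Li).length = min Bi.length Lrows.length := by
  unfold erow; rw [List.length_zipWith]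

/-- A member's length is at most the sum of all lengths. [folklore] -/
theorem length_le_sum_of_mem {L : List (List ℤ)} {r : List ℤ} (h : r ∈ L) : r.length ≤ (L.map List.length).sum :=
  List.le_sum_of_mem (List.mem_map.mpr ⟨r, h, rfl⟩)

/-- **Soundness of `psdCert`: the quadratic form of `B` is nonnegative on `ℝⁿ`.**  From the check:
`s² · xᵀBx = Σ_k D̂_k (Σ_i L̂_ik x_i)² + xᵀEx` with `D̂ ≥ 0` and `E` symmetric diagonally dominant, and `s > 0`. [folklore] -/
theorem form_nonneg_of_psdCert {n s : ℕ} {μ : ℤ} {B : List (List ℤ)} (h : psdCert n s μ B = true)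
    (x : Fin n → ℝ) : 0 ≤ ∑ i : Fin n, ∑ j : Fin n, x i * (ent B i j : ℝ) * x j := by
  unfold psdCert at h
  simp only [Bool.and_eq_true, decide_eq_true_eq] at h
  obtain ⟨⟨⟨⟨⟨hs, hsq⟩, hsym⟩, hlen⟩, hD⟩, hdd⟩ := h
  -- names for the oracle output (opaque from here on)
  generalize hDdef : (fpLDL (s : ℤ) n (subDiag μ 0 B)).1 = D at hlen hD hdd
  generalize hLdef : lowerRows (s : ℤ) (fpLDL (s : ℤ) n (subDiag μ 0 B)).2 = Lrows at hlen hD hdd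
  obtain ⟨hBlen, hBrows⟩ := isSquare_spec hsq
  have hBi : ∀ i : Fin n, (B.getD i []).length = n := fun i => by
    rw [List.getD_eq_getElem _ _ (by omega)]; exact hBrows _ (List.getElem_mem _)
  -- the residual kernel and its properties
  set M : ℕ := (Lrows.map List.length).sum with hM
  let Lf : Fin n → ℕ → ℝ := fun i k => (((Lrows.getD i []).getD k 0 : ℤ) : ℝ)
  let Df : ℕ → ℝ := fun k => ((D.getD k 0 : ℤ) : ℝ)
  let ef : Fin n → Fin n → ℤ := fun i j => ent B i j * ((s : ℤ) * s) - dot3 (Lrows.getD i []) D (Lrows.getD j [])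
  have hLi_len : ∀ i : Fin n, (Lrows.getD i []).length ≤ M := fun i => by
    apply length_le_sum_of_mem
    rw [List.getD_eq_getElem _ _ (by omega)]; exact List.getElem_mem _
  -- (1) decomposition  s²·B_ij = Σ_k L_ik D_k L_jk + e_ij
  have hdec : ∀ i j : Fin n, (ent B i j : ℝ) * ((s : ℝ) * s) = (∑ k ∈ range M, Lf i k * Df k * Lf j k) + (ef i j : ℝ) := by
    intro i j
    have : (ef i j : ℝ) = (ent B i j : ℝ) * ((s : ℝ) * s) - (dot3 (Lrows.getD i []) D (Lrows.getD j []) : ℝ) := by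
      simp only [ef]; push_cast; ring
    rw [this, dot3_eq_sum _ _ _ M (hLi_len i)]
    push_cast
    simp only [Lf, Df]
    ring
  -- (2) symmetry of e
  have hesymm : ∀ i j : Fin n, (ef i j : ℝ) = (ef j i : ℝ) := by
    intro i j
    simp only [ef]
    rw [isSymm_spec hsym i.2 j.2, dot3_comm]
  -- (3) diagonal dominance of e
  have hedd : ∀ i : Fin n, (∑ j : Fin n, if j = i then 0 else |(ef i j : ℝ)|) ≤ (ef i i : ℝ) := by
    intro i
    have hspec := ddRows_spec ((s : ℤ) * s) D Lrows B Lrows 0 hdd i (by omega)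
    obtain ⟨-, hrow⟩ := hspec
    simp only [zero_add] at hrow
    have hrlen : (erow ((s : ℤ) * s) D Lrows (B.getD i []) (Lrows.getD i [])).length = n := by
      rw [erow_length, hBi, hlen, min_self]
    rw [offAbs_eq, hrlen] at hrow
    have hZ : (∑ j : Fin n, if j = i then (0 : ℤ) else |ef i j|) ≤ ef i i := by
      have h1 : (∑ j : Fin n, if j = i then (0 : ℤ) else |ef i j|) =
          ∑ j ∈ range n, if j = (i : ℕ) then (0 : ℤ) else
            |(erow ((s : ℤ) * s) D Lrows (B.getD i []) (Lrows.getD i [])).getD j 0| := by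
        rw [← Fin.sum_univ_eq_sum_range (fun j => if j = (i : ℕ) then (0 : ℤ) else
            |(erow ((s : ℤ) * s) D Lrows (B.getD i []) (Lrows.getD i [])).getD j 0|) n]
        refine Finset.sum_congr rfl fun j _ => ?_
        by_cases hji : j = i
        · subst hji; simp
        · rw [if_neg hji, if_neg (fun h => hji (Fin.ext h)), erow_getD _ _ _ _ _ (hBi i) hlen j.2]
          rfl
      have h2 : (erow ((s : ℤ) * s) D Lrows (B.getD i []) (Lrows.getD i [])).getD i 0 = ef i i := by
        rw [erow_getD _ _ _ _ _ (hBi i) hlen i.2]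
        rfl
      rw [h1, ← h2]
      exact hrow
    have hR : ((∑ j : Fin n, if j = i then (0 : ℤ) else |ef i j| : ℤ) : ℝ) ≤ (ef i i : ℝ) := by exact_mod_cast hZ
    push_cast at hR
    exact hR
  -- (4) assemble
  have hDnn : ∀ k, 0 ≤ Df k := fun k => by
    simp only [Df]; exact_mod_cast getD_nonneg_of_all hD k
  have hgram := form_nonneg_of_gram M Lf Df hDnn x
  have hE := form_nonneg_of_diagDominant (fun i j => (ef i j : ℝ)) hesymm hedd x
  have hsum : (∑ i : Fin n, ∑ j : Fin n, x i * (ent B i j : ℝ) * x j) * ((s : ℝ) * s) =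
      (∑ i, ∑ j, x i * (∑ k ∈ range M, Lf i k * Df k * Lf j k) * x j) + ∑ i, ∑ j, x i * (ef i j : ℝ) * x j := by
    rw [← Finset.sum_add_distrib, Finset.sum_mul]
    refine Finset.sum_congr rfl fun i _ => ?_
    rw [← Finset.sum_add_distrib, Finset.sum_mul]
    refine Finset.sum_congr rfl fun j _ => ?_
    rw [show x i * (ent B i j : ℝ) * x j * ((s : ℝ) * s) = x i * ((ent B i j : ℝ) * ((s : ℝ) * s)) * x j by ring, hdec i j]
    ring
  have hs2 : (0 : ℝ) < (s : ℝ) * s := by positivity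
  have htot : 0 ≤ (∑ i : Fin n, ∑ j : Fin n, x i * (ent B i j : ℝ) * x j) * ((s : ℝ) * s) := by
    rw [hsum]; exact add_nonneg hgram hE
  exact (mul_nonneg_iff_of_pos_right hs2).mp htot

/-! ## §4 A kernel-decided instance (smoke test; the cluster blocks live in their own files) -/

/-- The tridiagonal `10·[[2,-1,0],[-1,2,-1],[0,-1,2]]` (λ_min = 10(2 − √2) ≈ 5.86) is certified positive semidefinite
by the kernel (scale `s = 2^20`, oracle shift `μ = 1`; the shift must be a positive integer below `λ_min(B)` up to rounding slack,
which is why certificate producers scale `B` to large integers). [folklore] -/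
example : psdCert 3 1048576 1 [[20, -10, 0], [-10, 20, -10], [0, -10, 20]] = true := by
  decide +kernel

/-- **`Matrix.PosSemidef` form of the certificate** for the real `n × n` matrix with entries `ent B i j`. [folklore] -/
theorem posSemidef_of_psdCert {n s : ℕ} {μ : ℤ} {B : List (List ℤ)} (h : psdCert n s μ B = true) :
    (Matrix.of fun i j : Fin n => (ent B i j : ℝ)).PosSemidef := by
  have hsym : isSymm n B = true := by
    unfold psdCert at h
    simp only [Bool.and_eq_true, decide_eq_true_eq] at h
    exact h.1.1.1.2
  refine Matrix.PosSemidef.of_dotProduct_mulVec_nonneg ?_ fun x => ?_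
  · ext i j
    simp only [Matrix.conjTranspose_apply, Matrix.of_apply, star_trivial]
    exact_mod_cast isSymm_spec hsym j.2 i.2
  · have := form_nonneg_of_psdCert h x
    simp only [dotProduct, Matrix.mulVec, Matrix.of_apply, star_trivial, Finset.mul_sum]
    refine this.trans_eq (Finset.sum_congr rfl fun i _ => Finset.sum_congr rfl fun j _ => by ring)

end Main

end Summit.HubbardSuperconductivity.HubbardLadder.PsdCert
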